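import Summits.Ventures.PercRepro.S1CoreCapChain
import Summits.Ventures.PercRepro.S1TriangleQ2
import Summits.Ventures.PercRepro.S1CellCaps

/-!
# PercRepro — THE CELL `(10, 11)`: an `e`-free core of rank `10` with `21` points satisfies `RLS` at level `4`
(p2, gen 20; SUBCLAIM-S1 §6.4)

The capped cell inequality `cellOK10 10 11 25 288` holds by kernel: `s₃ ≤ cq2 11 = 25` (LEMMA Q‴, S1TriangleQ2) and
`s₄ ≤ 288` at nullity `11` (the unconditional averaging chain, S1CoreCapChain; the cell needs `≤ 362`, the previous
cap was `411`). The exact-rational twin (mining/p2/g20/needs20.py) reads `0.9090` (`1.0608` before). The row `p = 10`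
of the `q = 4` window now ends at `(10, 10)`.

* `cell_ten_eleven_chain` — `cellOK10 10 11 25 288 = true` (decide + kernel);
* **`c025_core_ten_eleven`** — the cell.
Axioms: standard.
-/

open scoped Matroid

namespace PercRepro

namespace S1

open Set

variable {α : Type}

/-- The capped cell `(10, 11)` with `s₃ ≤ 25` and `s₄ ≤ 288`, by kernel. -/
theorem cell_ten_eleven_chain : cellOK10 10 11 25 288 = true := by decide +kernel

/-- **THE CELL `(10, 11)`**: an `e`-free core of rank `10` with `21` points satisfies `RLS` at level `4`. -/
theorem c025_core_ten_eleven (M : Matroid α) [M.Finite] (hR : M.eRank = (10 : ℕ)) (hn : M.E.ncard = 21)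
    (hfree : ∀ e ∈ M.E, ∃ A ⊆ M.E \ {e}, e ∉ M.closure A ∧ e ∉ M.closure ((M.E \ {e}) \ A)) :
    ThmN.RLS M 10 4 := by
  have hd : M.E.encard = M.eRank + ((11 : ℕ) : ℕ∞) := by
    rw [hR, ← M.ground_finite.cast_ncard_eq, hn]
    push_cast
    ring
  have hP : {C : Set α | M.IsCircuit C ∧ C.ncard = 3}.ncard ≤ 25 := by
    have h := core_ncard_triangles_le_cq2 M hfree hd
    rwa [show cq2 11 = 25 by decide] at h
  have hS : {C : Set α | M.IsCircuit C ∧ C.ncard = 4}.ncard ≤ 288 :=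
    ncard_fourCircuits_le_two_eighty_eight_uncond M hfree (by exact_mod_cast hd)
  exact rls_of_cellOK10 M 10 11 25 288 (by norm_num) hR hn hfree hP hS (by norm_num) cell_ten_eleven_chain

end S1

end PercRepro
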